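/-
Copyright (c) 2026. All rights reserved.
Released under Apache 2.0 license as described in the file LICENSE.
Authors: abc-iut cell, seat abc-iut-L4-t14 (gen 5; proof-only consumer wiring: the geometric column of
[AbsTopIII] Prop 4.2 (i) / Cor 4.5 at EVERY FINITE-COVOLUME base, over abc-iut-L4-d1's
«GENUINE-BASE-COVOLUME» producers and abc-iut-L4-t14's `hfin`-free columns).
-/
import Literature.AnabelianGeometry.AbsoluteAnabelian.ArchimedeanHolFieldFunctorGeometricRCPSLHfinFree
import Literature.AnabelianGeometry.AbsoluteAnabelian.ArchimedeanHolFieldFunctorGeometricPSLFiniteCovolumeCusps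
import HarnessLib

/-!
# [AbsTopIII] Prop 4.2 (i) / Cor 4.5 at every FINITE-COVOLUME base `X₀ = ℍ/Γ̄`

S. Mochizuki, *Topics in absolute anabelian geometry III*, proof of Prop 4.2 (i) p. 106 l. 14–19 (kurims
`paper:url-5493eb38cbb7`; bib key `MochizukiAbsTopIII2015`).  After abc-iut-L4-t14's `hfin`-free columns
(`…PSLHfinFree`, `…RCPSLHfinFree`, p467399/p467577) the ONLY residual of the geometric column at a
uniformised base `X₀ = ℍ/Γ̄` (`Γ̄` free-or-surface, non-abelian, acting freely and properly
discontinuously) is `hN : [N(Λ̄) : Λ̄] < ∞` for every finite-index `Λ̄ ≤ Γ̄`; abc-iut-L4-d1's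
`finiteIndex_subgroupOf_normalizer_of_finite_covolume_of_le'` (`…PSLFiniteCovolumeCusps`, over the tree's
Iwaniec-line theory of Fuchsian groups: Shimizu's lemma, cusp zones, Siegel's compact core) discharges it
for EVERY `Γ̄` whose lift `toGL(π⁻¹Γ̄) ≤ GL(2, ℝ)` has a measurable fundamental domain of FINITE
hyperbolic area — compact or cusped alike.  PROOF-ONLY composition (no definition, no named fact):

* ★★ `HolRS.isIdRigid_EA_mapsTo_pslQuotient_of_finiteVolume` / `HolRS.cor_4_5_geometric_mapsTo_pslQuotient_of_finiteVolume`
  — **the holomorphic geometric `EA` over `X₀ = ℍ/Γ̄` is ID-RIGID and Cor 4.5 (i)–(v) holds, for every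
  FINITE-COVOLUME `Γ̄`** (free-or-surface, non-abelian, acting freely and properly discontinuously);
  residual = the finite-area fundamental domain ONLY (`IsHypFundamentalDomain`, `volume F < ⊤`);
* ★★ `HolRS.RC.…_of_finiteVolume` — the print-faithful (RC) twins.

So at IUT's generic archimedean bases (once-punctured elliptic curves `E ∖ {x₀}`, NON-arithmetic) the
column needs exactly: a fundamental domain of finite hyperbolic area for the Möbius deck group (campaign
L; the tree's `Fuchsian.exists_isHypFundamentalDomain_of_isDiscreteSubgroup` gives a measurable one, its
finite AREA is the open step).  HONEST SCOPE: MODEL side of [AbsTopIII] §4 (model ≠ reconstruction).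
Classical; nothing here bears on [IUTchIII] Cor. 3.12.
-/

set_option autoImplicit false

noncomputable section

open scoped UpperHalfPlane MatrixGroups Matrix
open _root_.MulAction _root_.CategoryTheory _root_.MeasureTheory
open Literature.IUT.HodgeTheaters (IsFreeOrSurface)
open Matrix.SpecialLinearGroup (toGL)
open Literature.NumberTheory.Automorphic (IsHypFundamentalDomain)

namespace Literature.AnabelianGeometry.AbsoluteAnabelian

namespace HolRS

variable (Γ : Subgroup PSL2R) [ProperlyDiscontinuousSMul Γ ℍ] [IsCancelSMul Γ ℍ] {F : Set ℍ}

omit [IsCancelSMul Γ ℍ] in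
/-- **`hN` at every object of `Loc(PSL₂(ℝ), Γ̄)` from finite covolume** (abc-iut-L4-d1's
`finiteIndex_subgroupOf_normalizer_of_finite_covolume_of_le'` at every finite-index `Λ̄`; `Λ̄` non-abelian
by `LocObj.exists_mul_ne_mul_of_isFreeOrSurface`). [cite: MochizukiAbsTopIII2015, Proposition 4.2 (i) proof p.106] -/
theorem LocObj.finiteIndex_subgroupOf_normalizer_of_finiteVolume (hΓ : IsFreeOrSurface Γ)
    (hab : ∃ a b : Γ, a * b ≠ b * a)
    (hF : IsHypFundamentalDomain ((Γ.comap (QuotientGroup.mk' (Subgroup.center SL(2, ℝ)))).map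
      (toGL : SL(2, ℝ) →* GL (Fin 2) ℝ)) F)
    (hvol : volume F < ⊤) (Λ : _root_.Literature.AnabelianGeometry.AbsoluteAnabelian.LocObj Γ) :
    (Λ.toSubgroup.subgroupOf (Subgroup.normalizer (Λ.toSubgroup : Set PSL2R))).FiniteIndex := by
  haveI : (Λ.toSubgroup.subgroupOf Γ).FiniteIndex := Λ.finiteIndex
  exact finiteIndex_subgroupOf_normalizer_of_finite_covolume_of_le' Γ hF hvol Λ.toSubgroup Λ.le
    (HolRS.LocObj.exists_mul_ne_mul_of_isFreeOrSurface hΓ hab Λ)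

/-- ★★ **[AbsTopIII] Prop 4.2 (i) at every FINITE-COVOLUME base `X₀ = ℍ/Γ̄`**: for `Γ̄ ≤ PSL₂(ℝ)` free of
finite rank or an orientable surface group, non-abelian, acting freely and properly discontinuously on
`ℍ`, with a measurable fundamental domain of finite hyperbolic area for `toGL(π⁻¹Γ̄)`, the geometric `EA`
over `X₀` is ID-RIGID — no `hfin`, no arithmeticity, no compactness dichotomy.
[cite: MochizukiAbsTopIII2015, Proposition 4.2 (i) proof p.106] -/
theorem isIdRigid_EA_mapsTo_pslQuotient_of_finiteVolume (hΓ : IsFreeOrSurface Γ)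
    (hab : ∃ a b : Γ, a * b ≠ b * a)
    (hF : IsHypFundamentalDomain ((Γ.comap (QuotientGroup.mk' (Subgroup.center SL(2, ℝ)))).map
      (toGL : SL(2, ℝ) →* GL (Fin 2) ℝ)) F)
    (hvol : volume F < ⊤) :
    Literature.AnabelianGeometry.AbsoluteAnabelian.IsIdRigid
      (HolRS.geometricAutHolFieldFunctor fun Y : HolRS => Nonempty (Y ⟶ HolRS.pslQuotient Γ)).EA :=
  isIdRigid_EA_mapsTo_pslQuotient_of_isFreeOrSurface_hfinFree Γ hΓ hab
    (LocObj.finiteIndex_subgroupOf_normalizer_of_finiteVolume Γ hΓ hab hF hvol)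

/-- ★★ **Cor 4.5 (i)–(v) at every finite-covolume base** (same hypotheses).
[cite: MochizukiAbsTopIII2015, Corollary 4.5 pp.107–109] -/
theorem cor_4_5_geometric_mapsTo_pslQuotient_of_finiteVolume (hΓ : IsFreeOrSurface Γ)
    (hab : ∃ a b : Γ, a * b ≠ b * a)
    (hF : IsHypFundamentalDomain ((Γ.comap (QuotientGroup.mk' (Subgroup.center SL(2, ℝ)))).map
      (toGL : SL(2, ℝ) →* GL (Fin 2) ℝ)) F)
    (hvol : volume F < ⊤) :
    Literature.AnabelianGeometry.AbsoluteAnabelian.AbsTopIII.Cor_4_5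
      (Literature.AnabelianGeometry.AbsoluteAnabelian.archLogFrobeniusData
        (HolRS.geometricAutHolFieldFunctor fun Y : HolRS => Nonempty (Y ⟶ HolRS.pslQuotient Γ)))
      (Literature.AnabelianGeometry.AbsoluteAnabelian.archTelecoreData
        (HolRS.geometricAutHolFieldFunctor fun Y : HolRS => Nonempty (Y ⟶ HolRS.pslQuotient Γ))) :=
  cor_4_5_geometric_mapsTo_pslQuotient_of_isFreeOrSurface_hfinFree Γ hΓ hab
    (LocObj.finiteIndex_subgroupOf_normalizer_of_finiteVolume Γ hΓ hab hF hvol)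

/-- ★★ **Print-faithful (RC) morphisms, every finite-covolume base**: the geometric `EA` of the RC instance
over `X₀ = ℍ/Γ̄` is ID-RIGID (same hypotheses). [cite: MochizukiAbsTopIII2015, Proposition 4.2 (i) proof p.106] -/
theorem RC.isIdRigid_EA_mapsTo_pslQuotient_of_finiteVolume (hΓ : IsFreeOrSurface Γ)
    (hab : ∃ a b : Γ, a * b ≠ b * a)
    (hF : IsHypFundamentalDomain ((Γ.comap (QuotientGroup.mk' (Subgroup.center SL(2, ℝ)))).map
      (toGL : SL(2, ℝ) →* GL (Fin 2) ℝ)) F)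
    (hvol : volume F < ⊤) :
    Literature.AnabelianGeometry.AbsoluteAnabelian.IsIdRigid
      (HolRS.geometricAutHolFieldFunctorRC fun Y : RC =>
        Nonempty (Y ⟶ HolRS.toRC.obj (HolRS.pslQuotient Γ))).EA :=
  RC.isIdRigid_EA_mapsTo_pslQuotient_of_isFreeOrSurface_hfinFree Γ hΓ hab
    (LocObj.finiteIndex_subgroupOf_normalizer_of_finiteVolume Γ hΓ hab hF hvol)

/-- ★★ **Cor 4.5 (i)–(v), print-faithful morphisms, every finite-covolume base** (same hypotheses).
[cite: MochizukiAbsTopIII2015, Corollary 4.5 pp.107–109] -/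
theorem RC.cor_4_5_geometric_mapsTo_pslQuotient_of_finiteVolume (hΓ : IsFreeOrSurface Γ)
    (hab : ∃ a b : Γ, a * b ≠ b * a)
    (hF : IsHypFundamentalDomain ((Γ.comap (QuotientGroup.mk' (Subgroup.center SL(2, ℝ)))).map
      (toGL : SL(2, ℝ) →* GL (Fin 2) ℝ)) F)
    (hvol : volume F < ⊤) :
    Literature.AnabelianGeometry.AbsoluteAnabelian.AbsTopIII.Cor_4_5
      (Literature.AnabelianGeometry.AbsoluteAnabelian.archLogFrobeniusData
        (HolRS.geometricAutHolFieldFunctorRC fun Y : RC =>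
          Nonempty (Y ⟶ HolRS.toRC.obj (HolRS.pslQuotient Γ))))
      (Literature.AnabelianGeometry.AbsoluteAnabelian.archTelecoreData
        (HolRS.geometricAutHolFieldFunctorRC fun Y : RC =>
          Nonempty (Y ⟶ HolRS.toRC.obj (HolRS.pslQuotient Γ)))) :=
  RC.cor_4_5_geometric_mapsTo_pslQuotient_of_isFreeOrSurface_hfinFree Γ hΓ hab
    (LocObj.finiteIndex_subgroupOf_normalizer_of_finiteVolume Γ hΓ hab hF hvol)

end HolRS

end Literature.AnabelianGeometry.AbsoluteAnabelian

end
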